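import Literature.NumberTheory.Sieve.LinearEquationsInPrimesProofs
import Literature.NumberTheory.Sieve.LinearEquationsInPrimesSingularSeries
import Literature.NumberTheory.LFunctions.MertensElementary
import Mathlib
import HarnessLib

/-!
# Route `LeeYangFibres`, crux `RelativeDimOne` (stmt-Parity-14113), line `single-moebius-split`,
# stub `stub_termBound` — auxiliary file 3: `∏_p β_p ≤ (2e⁵ log(3⁹ X))^s` for non-degenerate
# `d = 1` systems whose coefficients and minors have product `≤ X`

The dilated systems `φ_i(m) = (a_i M₀) m + ψ_i(n₀)` met in the reduction of term `j ≥ 1` to the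
single-Möbius hybrid atom have LARGE leading coefficients (`≍ M₀`), so the tree's
`stub_singularProduct_le_loglog_pow` (systems of size `≤ L`) does not apply. This file proves the
variant needed there, with the same mechanism (Green–Tao Lemma 1.3 at `d = 1`):

* at a prime `p` not dividing `Π := ∏_i |φ̇_i| · ∏_{i ≠ i'} |φ̇_i φ_{i'}(0) − φ̇_{i'} φ_i(0)|` every
  coefficient is a unit and the killed residues `−φ_i(0)/φ̇_i` are distinct, so `β_p ≤ 1`
  (Bernoulli); at every prime `β_p ≤ (p/(p−1))^s` (`localFactor_prime_le`);
* hence every partial product is `≤ ∏_{p ∣ Π} (p/(p−1))^s ≤ (2e⁵ log log(3⁹Π))^s` (Landau's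
  `Π/φ(Π) ≤ 2e⁵ log log Π`, tree `MertensBound.totient_div_self_ge`), and `log log ≤ log`;
* the ordered limit `singularProduct` obeys the same bound (`tendsto_singularProductPartial_holds`).

Registered sub-goal: `termBound_aux_singularProduct_le`.
-/

noncomputable section

open scoped BigOperators Classical
open Finset Filter Literature.NumberTheory.Sieve Literature.NumberTheory.LFunctions

namespace Summit.Parity.GeneralizedHardyLittlewood.Cruxes.RelativeDimOne.SingleMoebiusSplit

variable {s : ℕ}

/-! ### Dimension one: coefficients and minors -/

/-- Non-degeneracy in dimension one: every leading coefficient is non-zero. -/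
theorem coeff_zero_ne_zero {Φ : Fin s → AffLinForm 1} (hΦ : IsNondegenerateSystem Φ) (i : Fin s) :
    (Φ i).coeff 0 ≠ 0 := by
  intro h
  apply hΦ.1 i
  funext j
  rw [Subsingleton.elim j 0, Pi.zero_apply]
  exact h

/-- Non-degeneracy in dimension one: the minors `a_i b_k − a_k b_i` (`i ≠ k`) are non-zero. -/
theorem minor_ne_zero' {Φ : Fin s → AffLinForm 1} (hΦ : IsNondegenerateSystem Φ) {i k : Fin s}
    (hik : i ≠ k) : (Φ i).coeff 0 * (Φ k).const - (Φ k).coeff 0 * (Φ i).const ≠ 0 := by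
  -- adapted from `…AbsoluteUpgradeSingularProductLogLog` (private `minor_ne_zero`)
  intro hD
  have hpt : ∀ n, (Φ k).coeff 0 * (Φ i).eval n = (Φ i).coeff 0 * (Φ k).eval n := fun n => by
    simp only [AffLinForm.eval, Fin.sum_univ_one]
    linear_combination -hD
  exact coeff_zero_ne_zero hΦ i (hΦ.2 i k hik _ _ hpt).2

/-! ### Local factors -/

/-- At a prime `p` where every `a_i` is a unit, `ψ_i` kills the residue `−b_i/a_i`:
`goodCount Φ p + #{−b_i/a_i : i} ≤ p`. -/
theorem goodCount_add_card_roots_le' {Φ : Fin s → AffLinForm 1} {p : ℕ} [Fact p.Prime]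
    (ha : ∀ i, ((Φ i).coeff 0 : ZMod p) ≠ 0) :
    goodCount Φ p + #(univ.image fun (i : Fin s) (_ : Fin 1) =>
      -((Φ i).const : ZMod p) / ((Φ i).coeff 0 : ZMod p)) ≤ p := by
  -- adapted from `…AbsoluteUpgradeSingularProductLogLog` (private `goodCount_add_card_roots_le`)
  unfold goodCount
  rw [← Finset.card_union_of_disjoint]
  · calc _ ≤ Fintype.card (Fin 1 → ZMod p) := Finset.card_le_univ _
      _ = p := by rw [card_zmod_pow, pow_one]
  · rw [Finset.disjoint_left]
    intro v hv hv'
    obtain ⟨i, -, rfl⟩ := Finset.mem_image.mp hv'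
    refine (Finset.mem_filter.mp hv).2 i ?_
    rw [AffLinForm.modEval, Fin.sum_univ_one, ← eq_neg_iff_add_eq_zero, mul_div_assoc',
      mul_div_cancel_left₀ _ (ha i)]

/-- Bernoulli: for `p ≥ 2` and `G + s ≤ p`, `p⁻¹ (p/(p−1))^s G ≤ 1` (`1 − s/p ≤ (1 − 1/p)^s`). -/
theorem inv_mul_pow_mul_le_one' {p s : ℕ} (hp : 2 ≤ p) {G : ℝ} (hG : G + s ≤ p) :
    ((p : ℝ) ^ 1)⁻¹ * (((p : ℝ) / (p - 1)) ^ s * G) ≤ 1 := by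
  -- adapted from `…AbsoluteUpgradeSingularProductLogLog` (private `inv_mul_pow_mul_le_one`)
  have hp2 : (2 : ℝ) ≤ p := by exact_mod_cast hp
  have hp0 : (0 : ℝ) < p := by linarith
  have hp1 : (0 : ℝ) < (p : ℝ) - 1 := by linarith
  have hX0 : (0 : ℝ) ≤ ((p : ℝ) / (p - 1)) ^ s := pow_nonneg (div_nonneg hp0.le hp1.le) s
  have hB : (p : ℝ) - s ≤ p * (1 - 1 / (p : ℝ)) ^ s := by
    have ha : (-2 : ℝ) ≤ -(1 / (p : ℝ)) := by
      linarith [one_div_le_one_div_of_le two_pos hp2, (one_div_nonneg.mpr hp0.le : (0:ℝ) ≤ 1 / p)]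
    calc (p : ℝ) - s = p * (1 + s * -(1 / (p : ℝ))) := by field_simp; ring
      _ ≤ p * (1 + -(1 / (p : ℝ))) ^ s := mul_le_mul_of_nonneg_left (one_add_mul_le_pow ha s) hp0.le
      _ = p * (1 - 1 / (p : ℝ)) ^ s := by ring
  have hXY : ((p : ℝ) / (p - 1)) ^ s * (1 - 1 / (p : ℝ)) ^ s = 1 := by
    rw [← mul_pow, show (p : ℝ) / (p - 1) * (1 - 1 / (p : ℝ)) = 1 by field_simp, one_pow]
  rw [pow_one]
  calc (p : ℝ)⁻¹ * (((p : ℝ) / (p - 1)) ^ s * G)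
      ≤ (p : ℝ)⁻¹ * (((p : ℝ) / (p - 1)) ^ s * (p * (1 - 1 / (p : ℝ)) ^ s)) :=
        mul_le_mul_of_nonneg_left (mul_le_mul_of_nonneg_left (by linarith) hX0)
          (inv_nonneg.mpr hp0.le)
    _ = (p : ℝ)⁻¹ * p * (((p : ℝ) / (p - 1)) ^ s * (1 - 1 / (p : ℝ)) ^ s) := by ring
    _ = 1 := by rw [hXY, inv_mul_cancel₀ hp0.ne', one_mul]

/-- At a prime `p` where all `a_i` are units and all minors are non-zero mod `p`: `β_p ≤ 1`. -/
theorem localFactor_le_one_of_minors' {Φ : Fin s → AffLinForm 1} {p : ℕ} (hp : p.Prime)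
    (ha : ∀ i, ((Φ i).coeff 0 : ZMod p) ≠ 0)
    (hmin : ∀ i k, i ≠ k →
      (((Φ i).coeff 0 * (Φ k).const - (Φ k).coeff 0 * (Φ i).const : ℤ) : ZMod p) ≠ 0) :
    localFactor Φ p ≤ 1 := by
  -- adapted from `…AbsoluteUpgradeSingularProductLogLog` (private `localFactor_le_one_of_minors`)
  haveI := Fact.mk hp
  have hinj : Function.Injective fun (i : Fin s) (_ : Fin 1) =>
      -((Φ i).const : ZMod p) / ((Φ i).coeff 0 : ZMod p) := by
    intro i k hik
    by_contra hne
    have h : -((Φ i).const : ZMod p) / ((Φ i).coeff 0 : ZMod p) =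
        -((Φ k).const : ZMod p) / ((Φ k).coeff 0 : ZMod p) := congr_fun hik 0
    rw [div_eq_div_iff (ha i) (ha k)] at h
    refine hmin i k hne ?_
    push_cast
    linear_combination h
  have h2 := goodCount_add_card_roots_le' ha
  rw [Finset.card_image_of_injective _ hinj, Finset.card_univ, Fintype.card_fin] at h2
  have hG : (goodCount Φ p : ℝ) + s ≤ p := by exact_mod_cast h2
  rw [localFactor_prime]
  exact inv_mul_pow_mul_le_one' hp.two_le hG

/-! ### Landau's bound `∏_{p ∣ m} p/(p−1) ≤ 2e⁵ log log m` -/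

/-- `0 ≤ p/(p−1)` and `1 ≤ p/(p−1)` for `p ≥ 2`. -/
theorem div_pred_nonneg_one_le' {p : ℕ} (hp : 2 ≤ p) :
    (0 : ℝ) ≤ (p : ℝ) / (p - 1) ∧ (1 : ℝ) ≤ (p : ℝ) / (p - 1) := by
  have hp2 : (2 : ℝ) ≤ p := by exact_mod_cast hp
  have hp1 : (0 : ℝ) < (p : ℝ) - 1 := by linarith
  exact ⟨div_nonneg (by linarith) hp1.le, by rw [le_div_iff₀ hp1]; linarith⟩

/-- `2 ≤ log log m` for `m ≥ 3⁹`. -/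
theorem two_le_loglog {m : ℕ} (hm : 3 ^ 9 ≤ m) : 2 ≤ Real.log (Real.log m) := by
  -- adapted from `…AbsoluteUpgradeSingularProductLogLog` (private `nine_le_log`)
  have h3 := MertensBound.one_lt_log_three
  have hy9 : 9 ≤ Real.log m := by
    have h1 : Real.log ((3 : ℕ) ^ 9 : ℕ) ≤ Real.log m :=
      Real.log_le_log (by positivity) (by exact_mod_cast hm)
    rw [Nat.cast_pow, Real.log_pow] at h1
    push_cast at h1
    linarith
  have h1 : Real.log 9 ≤ Real.log (Real.log m) := Real.log_le_log (by norm_num) hy9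
  rw [show (9 : ℝ) = 3 ^ 2 by norm_num, Real.log_pow] at h1
  push_cast at h1
  linarith

/-- Landau: `∏_{p ∣ m} p/(p−1) = m/φ(m) ≤ 2e⁵ log log m` for `m ≥ 3⁹`. -/
theorem prod_primeFactors_le_loglog' {m : ℕ} (hm : 3 ^ 9 ≤ m) :
    ∏ p ∈ m.primeFactors, ((p : ℝ) / (p - 1)) ≤ 2 * Real.exp 5 * Real.log (Real.log m) := by
  -- adapted from `…AbsoluteUpgradeSingularProductLogLog` (private `prod_primeFactors_le_loglog`)
  have hm0 : (0 : ℝ) < m := by exact_mod_cast lt_of_lt_of_le (by norm_num) hm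
  have hll : 0 < Real.log (Real.log m) := by linarith [two_le_loglog hm]
  have h := MertensBound.totient_div_self_ge m hm
  rw [MertensBound.totient_eq_mul_prod_one_sub_inv, mul_div_cancel_left₀ _ hm0.ne'] at h
  have hPQ : (∏ p ∈ m.primeFactors, ((p : ℝ) / (p - 1))) *
      ∏ p ∈ m.primeFactors, (1 - 1 / (p : ℝ)) = 1 := by
    rw [← Finset.prod_mul_distrib]
    refine Finset.prod_eq_one fun p hp => ?_
    have hp2 : (2 : ℝ) ≤ p := by exact_mod_cast (Nat.prime_of_mem_primeFactors hp).two_le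
    have hp0 : (p : ℝ) ≠ 0 := by positivity
    have hp1 : (p : ℝ) - 1 ≠ 0 := by linarith
    field_simp
  have hP0 : 0 ≤ ∏ p ∈ m.primeFactors, ((p : ℝ) / (p - 1)) := Finset.prod_nonneg fun p hp =>
    (div_pred_nonneg_one_le' (Nat.prime_of_mem_primeFactors hp).two_le).1
  have h1 : (∏ p ∈ m.primeFactors, ((p : ℝ) / (p - 1))) * (Real.exp (-5) /
      (2 * Real.log (Real.log m))) ≤ 1 :=
    (mul_le_mul_of_nonneg_left h hP0).trans_eq hPQ
  rw [mul_div_assoc', div_le_one (by positivity)] at h1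
  calc ∏ p ∈ m.primeFactors, ((p : ℝ) / (p - 1))
      = (∏ p ∈ m.primeFactors, ((p : ℝ) / (p - 1))) * Real.exp (-5) * Real.exp 5 := by
        rw [mul_assoc, ← Real.exp_add]; norm_num
    _ ≤ 2 * Real.log (Real.log m) * Real.exp 5 := mul_le_mul_of_nonneg_right h1 (Real.exp_pos _).le
    _ = 2 * Real.exp 5 * Real.log (Real.log m) := by ring


/-! ### The partial products and the singular product -/

/-- **The partial products**: `∏_{p ≤ x} β_p ≤ ∏_{p ∣ Π} (p/(p−1))^s` with
`Π = ∏_i |a_i| · ∏_{i ≠ k} |a_i b_k − a_k b_i|` (`β_p ≤ 1` off `Π`, `β_p ≤ (p/(p−1))^s` always). -/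
theorem singularProductPartial_le_prod_primeFactors {Φ : Fin s → AffLinForm 1}
    (hΦ : IsNondegenerateSystem Φ) (x : ℕ) :
    singularProductPartial Φ x ≤
      ∏ p ∈ ((∏ i, ((Φ i).coeff 0).natAbs) * ∏ ik ∈ (Finset.univ : Finset (Fin s)).offDiag,
          ((Φ ik.1).coeff 0 * (Φ ik.2).const - (Φ ik.2).coeff 0 * (Φ ik.1).const).natAbs).primeFactors,
        ((p : ℝ) / (p - 1)) ^ s := by
  set P0 : ℕ := (∏ i, ((Φ i).coeff 0).natAbs) * ∏ ik ∈ (Finset.univ : Finset (Fin s)).offDiag,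
    ((Φ ik.1).coeff 0 * (Φ ik.2).const - (Φ ik.2).coeff 0 * (Φ ik.1).const).natAbs with hP0
  have hP00 : P0 ≠ 0 := mul_ne_zero
    (Finset.prod_ne_zero_iff.mpr fun i _ => Int.natAbs_ne_zero.mpr (coeff_zero_ne_zero hΦ i))
    (Finset.prod_ne_zero_iff.mpr fun ik hik =>
      Int.natAbs_ne_zero.mpr (minor_ne_zero' hΦ (Finset.mem_offDiag.mp hik).2.2))
  have hdvdA : ∀ i, ((Φ i).coeff 0).natAbs ∣ P0 := fun i =>
    (Finset.dvd_prod_of_mem (fun i => ((Φ i).coeff 0).natAbs) (Finset.mem_univ i)).mul_right _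
  have hdvdM : ∀ i k, i ≠ k →
      ((Φ i).coeff 0 * (Φ k).const - (Φ k).coeff 0 * (Φ i).const).natAbs ∣ P0 :=
    fun i k hik => (Finset.dvd_prod_of_mem (fun ik : Fin s × Fin s =>
      ((Φ ik.1).coeff 0 * (Φ ik.2).const - (Φ ik.2).coeff 0 * (Φ ik.1).const).natAbs)
      (a := (i, k)) (Finset.mem_offDiag.mpr ⟨Finset.mem_univ i, Finset.mem_univ k, hik⟩)).mul_left _
  have hmem : ∀ p ∈ Nat.primesLE x, p.Prime := fun p hp => (Nat.mem_primesLE.mp hp).2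
  unfold singularProductPartial
  calc ∏ p ∈ Nat.primesLE x, localFactor Φ p
      ≤ ∏ p ∈ Nat.primesLE x, (if p ∣ P0 then ((p : ℝ) / (p - 1)) ^ s else 1) := by
        refine Finset.prod_le_prod (fun p _ => localFactor_nonneg Φ p) fun p hp => ?_
        have hpp := hmem p hp
        split_ifs with hpP0
        · exact localFactor_prime_le Φ hpp
        · refine localFactor_le_one_of_minors' hpp (fun i hz => hpP0 ?_) (fun i k hik hz => hpP0 ?_)
          · rw [ZMod.intCast_zmod_eq_zero_iff_dvd, Int.natCast_dvd] at hz
            exact hz.trans (hdvdA i)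
          · rw [ZMod.intCast_zmod_eq_zero_iff_dvd, Int.natCast_dvd] at hz
            exact hz.trans (hdvdM i k hik)
    _ = ∏ p ∈ (Nat.primesLE x).filter (· ∣ P0), ((p : ℝ) / (p - 1)) ^ s :=
        (Finset.prod_filter _ _).symm
    _ ≤ ∏ p ∈ P0.primeFactors, ((p : ℝ) / (p - 1)) ^ s := by
        refine Finset.prod_le_prod_of_subset_of_one_le (fun p hp => ?_) (fun p hp => ?_)
          (fun p hp _ => ?_)
        · obtain ⟨hp1, hp2⟩ := Finset.mem_filter.mp hp
          exact Nat.mem_primeFactors.mpr ⟨hmem p hp1, hp2, hP00⟩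
        · exact pow_nonneg (div_pred_nonneg_one_le' (hmem p (Finset.mem_filter.mp hp).1).two_le).1 _
        · exact one_le_pow₀ (div_pred_nonneg_one_le' (Nat.prime_of_mem_primeFactors hp).two_le).2

/-- **`∏_p β_p ≤ (2e⁵ log(3⁹X))^s`** (registered sub-goal for `stub_termBound`): for a non-degenerate
`d = 1` system of `s` forms whose product `Π` of leading coefficients and minors (in absolute value)
is at most `X`, `singularProduct Φ ≤ (2e⁵ log(3⁹ X))^s` — every partial product is
`≤ ∏_{p ∣ 3⁹Π} (p/(p−1))^s = ((3⁹Π)/φ(3⁹Π))^s ≤ (2e⁵ log log(3⁹Π))^s ≤ (2e⁵ log(3⁹X))^s`, and the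
bound passes to the ordered limit (Green–Tao Lemma 1.3). -/
theorem termBound_aux_singularProduct_le : ∀ (s : ℕ) (Φ : Fin s → AffLinForm 1),
    IsNondegenerateSystem Φ → ∀ (X : ℝ),
    (((∏ i, ((Φ i).coeff 0).natAbs) * ∏ ik ∈ (Finset.univ : Finset (Fin s)).offDiag,
        ((Φ ik.1).coeff 0 * (Φ ik.2).const - (Φ ik.2).coeff 0 * (Φ ik.1).const).natAbs : ℕ) : ℝ)
        ≤ X →
    singularProduct Φ ≤ (2 * Real.exp 5 * Real.log (3 ^ 9 * X)) ^ s := by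
  intro s Φ hΦ X hX
  set P0 : ℕ := (∏ i, ((Φ i).coeff 0).natAbs) * ∏ ik ∈ (Finset.univ : Finset (Fin s)).offDiag,
    ((Φ ik.1).coeff 0 * (Φ ik.2).const - (Φ ik.2).coeff 0 * (Φ ik.1).const).natAbs with hP0
  have hP00 : P0 ≠ 0 := mul_ne_zero
    (Finset.prod_ne_zero_iff.mpr fun i _ => Int.natAbs_ne_zero.mpr (coeff_zero_ne_zero hΦ i))
    (Finset.prod_ne_zero_iff.mpr fun ik hik =>
      Int.natAbs_ne_zero.mpr (minor_ne_zero' hΦ (Finset.mem_offDiag.mp hik).2.2))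
  -- `Π' = 3⁹ Π ≥ 3⁹`
  set P1 : ℕ := 3 ^ 9 * P0 with hP1
  have hP19 : 3 ^ 9 ≤ P1 := Nat.le_mul_of_pos_right _ (Nat.pos_of_ne_zero hP00)
  have hP10 : P1 ≠ 0 := by positivity
  have hsub : P0.primeFactors ⊆ P1.primeFactors := Nat.primeFactors_mono (Dvd.intro_left _ rfl) hP10
  -- `log log Π' ≤ log (3⁹ X)`
  have hP1X : (P1 : ℝ) ≤ 3 ^ 9 * X := by
    have h1 : (P1 : ℝ) = (3 : ℝ) ^ 9 * (P0 : ℝ) := by rw [hP1]; push_cast; ring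
    rw [h1]
    exact mul_le_mul_of_nonneg_left hX (by norm_num)
  have hP1pos : (0 : ℝ) < P1 := by exact_mod_cast Nat.pos_of_ne_zero hP10
  have hlogP1 : 0 < Real.log P1 := Real.log_pos (by exact_mod_cast lt_of_lt_of_le (by norm_num) hP19)
  have hll : Real.log (Real.log P1) ≤ Real.log (3 ^ 9 * X) :=
    calc Real.log (Real.log P1) ≤ Real.log P1 - 1 := Real.log_le_sub_one_of_pos hlogP1
      _ ≤ Real.log P1 := by linarith
      _ ≤ Real.log (3 ^ 9 * X) := Real.log_le_log hP1pos hP1X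
  have hll0 : 0 ≤ Real.log (Real.log P1) := by linarith [two_le_loglog hP19]
  -- the uniform bound for the partial products
  have hpart : ∀ x, singularProductPartial Φ x ≤ (2 * Real.exp 5 * Real.log (3 ^ 9 * X)) ^ s := by
    intro x
    calc singularProductPartial Φ x ≤ ∏ p ∈ P0.primeFactors, ((p : ℝ) / (p - 1)) ^ s :=
          singularProductPartial_le_prod_primeFactors hΦ x
      _ ≤ ∏ p ∈ P1.primeFactors, ((p : ℝ) / (p - 1)) ^ s := by
          refine Finset.prod_le_prod_of_subset_of_one_le hsub (fun p hp => ?_) fun p hp _ => ?_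
          · exact pow_nonneg (div_pred_nonneg_one_le' (Nat.prime_of_mem_primeFactors hp).two_le).1 _
          · exact one_le_pow₀ (div_pred_nonneg_one_le' (Nat.prime_of_mem_primeFactors hp).two_le).2
      _ = (∏ p ∈ P1.primeFactors, ((p : ℝ) / (p - 1))) ^ s := Finset.prod_pow _ _ _
      _ ≤ (2 * Real.exp 5 * Real.log (Real.log P1)) ^ s :=
          pow_le_pow_left₀ (Finset.prod_nonneg fun p hp =>
            (div_pred_nonneg_one_le' (Nat.prime_of_mem_primeFactors hp).two_le).1)
            (prod_primeFactors_le_loglog' hP19) s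
      _ ≤ (2 * Real.exp 5 * Real.log (3 ^ 9 * X)) ^ s :=
          pow_le_pow_left₀ (by positivity) (mul_le_mul_of_nonneg_left hll (by positivity)) s
  exact le_of_tendsto' (tendsto_singularProductPartial_holds 1 s Φ hΦ) hpart

end Summit.Parity.GeneralizedHardyLittlewood.Cruxes.RelativeDimOne.SingleMoebiusSplit
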